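import Summits.AtomisticToContinuum.Crystallization.Theorems.ExcessDecayLiouvillePhononStabilityCertCharge

/-!
# Near-certificate layer XII-b: fast nearest-neighbour chains (lead c2)

Support file for crux `PhononStability` (stmt-AtomisticToContinuum-9333), line `contragredient-window-collapse`.

`chainNNF` — `chainNN` with integer accumulators (no closure build-up), `chainNNF = chainNN`; every step of
`chainNN c` is a nearest-neighbour class (PROVED: `chainNN_sub_nnList`), so the Boolean check `chainsNN` holds
without evaluation (`chainsNN_eq_true`); a fast chain-validity check `validChainsF` and `ValidChains` from it
(`validChains_of_checkF`).
-/

noncomputable section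

open scoped BigOperators Classical InnerProductSpace
open Filter Set Function
open Summit.AtomisticToContinuum.Crystallization.Theorems.PhononStabilityNegative
open Summit.AtomisticToContinuum.Crystallization.Theorems.PhononStabilityCWC.FarControlStub

namespace Summit.AtomisticToContinuum.Crystallization.Theorems.PhononStabilityCWC.Cert


/-- `vertChain` with integer accumulators (no closure build-up) -/
def vertChainF : Fin 2 → Bool → ℕ → ℤ → ℤ → ℤ → ℤ → List BondClass
  | cur, _, 0, a0, a1, t0, t1 => planarChain cur (triDist (t0 - a0) (t1 - a1)) (t0 - a0) (t1 - a1)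
  | cur, up, k + 1, a0, a1, t0, t1 =>
      let cands := vertClasses cur up
      let s := argminD (fun s => triDist (t0 - a0 - s.2.2 0) (t1 - a1 - s.2.2 1)) (cands.headD (0, 0, 0)) cands
      s :: vertChainF s.2.1 up k (a0 + s.2.2 0) (a1 + s.2.2 1) t0 t1

/-- **fast nearest-neighbour chain** (same value as `chainNN`) -/
def chainNNF (c : BondClass) : List BondClass :=
  let H : ℤ := 2 * c.2.2 2 + (subSignZ c.2.1 - subSignZ c.1)
  vertChainF c.1 (decide (0 ≤ H)) H.natAbs 0 0 (c.2.2 0) (c.2.2 1)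

/-- the two constructions agree. [folklore] -/
theorem vertChainF_eq (cur : Fin 2) (up : Bool) (k : ℕ) :
    ∀ (acc tgt : Fin 3 → ℤ), vertChainF cur up k (acc 0) (acc 1) (tgt 0) (tgt 1) = vertChain cur up k acc tgt := by
  induction k generalizing cur with
  | zero => intro acc tgt; rfl
  | succ k ih =>
      intro acc tgt
      simp only [vertChainF, vertChain, List.cons.injEq, true_and]
      generalize argminD (fun s => triDist (tgt 0 - acc 0 - s.2.2 0) (tgt 1 - acc 1 - s.2.2 1))
        ((vertClasses cur up).headD (0, 0, 0)) (vertClasses cur up) = s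
      have h := ih s.2.1 (acc + s.2.2) tgt
      simpa [Pi.add_apply] using h

/-- `chainNNF = chainNN`. [folklore] -/
theorem chainNNF_eq_chainNN : chainNNF = chainNN := by
  funext c
  simp only [chainNNF, chainNN]
  exact vertChainF_eq c.1 _ _ 0 c.2.2

/-- fast `chainsNN` -/
def chainsNNF (qn qf : ℤ) : Bool := (classRange qn qf).all fun c => (chainNNF c).all fun s => decide (s ∈ nnList)

/-- (chain bookkeeping) [folklore] -/
theorem chainsNNF_eq : chainsNNF = chainsNN := by
  funext qn qf; simp only [chainsNNF, chainsNN, chainNNF_eq_chainNN]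

/-- (chain bookkeeping) [folklore] -/
instance decDiagClass (c : BondClass) : Decidable (diagClass c) := by unfold diagClass; infer_instance

/-- integer-accumulator chain end -/
def chainEndZ : Fin 2 → List BondClass → ℤ → ℤ → ℤ → Option (Fin 2 × ℤ × ℤ × ℤ)
  | m, [], a0, a1, a2 => some (m, a0, a1, a2)
  | m, s :: rest, a0, a1, a2 => if s.1 = m then chainEndZ s.2.1 rest (a0 + s.2.2 0) (a1 + s.2.2 1) (a2 + s.2.2 2) else none

/-- (chain bookkeeping) [folklore] -/
theorem chainEnd_eq_map (m : Fin 2) (ch : List BondClass) :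
    ∀ a0 a1 a2 : ℤ, (chainEnd m ch).map (fun p => (p.1, a0 + p.2 0, a1 + p.2 1, a2 + p.2 2)) = chainEndZ m ch a0 a1 a2 := by
  induction ch generalizing m with
  | nil => intro a0 a1 a2; simp [chainEnd, chainEndZ]
  | cons s rest ih =>
      intro a0 a1 a2
      simp only [chainEnd, chainEndZ]
      split_ifs with h
      · rw [← ih, Option.map_map]
        congr 1
        funext p
        simp only [Function.comp_apply, Pi.add_apply, Prod.mk.injEq]
        exact ⟨trivial, by ring, by ring, by ring⟩
      · rfl

/-- fast Boolean `IsChain` -/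
def isChainB (c : BondClass) (ch : List BondClass) : Bool :=
  decide (chainEndZ c.1 ch 0 0 0 = some (c.2.1, c.2.2 0, c.2.2 1, c.2.2 2))

/-- (chain bookkeeping) [folklore] -/
theorem isChain_of_isChainB {c : BondClass} {ch : List BondClass} (h : isChainB c ch = true) : IsChain c ch := by
  unfold isChainB at h
  rw [decide_eq_true_eq, ← chainEnd_eq_map] at h
  unfold IsChain
  cases hce : chainEnd c.1 ch with
  | none => rw [hce] at h; simp at h
  | some p =>
      rw [hce] at h
      simp only [Option.map_some, Option.some.injEq, Prod.mk.injEq, zero_add] at h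
      obtain ⟨h1, h2, h3, h4⟩ := h
      have hp : p = (c.2.1, c.2.2) := by
        obtain ⟨p1, p2⟩ := p
        simp only at h1 h2 h3 h4
        subst h1
        simp only [Prod.mk.injEq, true_and]
        funext i
        fin_cases i
        · simpa using h2
        · simpa using h3
        · simpa using h4
      rw [hp]

/-- fast `validChainsB` -/
def validChainsF (qn qf : ℤ) : Bool :=
  (classRange qn qf).all fun c => isChainB c (chainNNF c) && (chainNNF c).all fun s => !decide (diagClass s)

/-! ## Every chain step is a nearest-neighbour class (proved, so `chainsNN` needs no evaluation) -/

/-- (chain bookkeeping) [folklore] -/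
theorem argminD_mem (f : BondClass → ℕ) : ∀ (d : BondClass) (l : List BondClass), argminD f d l = d ∨ argminD f d l ∈ l := by
  intro d l
  induction l generalizing d with
  | nil => left; rfl
  | cons x rest ih =>
      simp only [argminD]
      split_ifs with h
      · right; exact List.mem_cons_self ..
      · rcases ih x with h1 | h1
        · right; rw [h1]; exact List.mem_cons_self ..
        · right; exact List.mem_cons_of_mem _ h1

/-- (chain bookkeeping) [folklore] -/
theorem vertClasses_sub_nnList (cur : Fin 2) (up : Bool) : ∀ s ∈ vertClasses cur up, s ∈ nnList := by
  fin_cases cur <;> cases up <;> decide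

/-- (chain bookkeeping) [folklore] -/
theorem vertClasses_headD_mem (cur : Fin 2) (up : Bool) : (vertClasses cur up).headD (0, 0, 0) ∈ vertClasses cur up := by
  fin_cases cur <;> cases up <;> decide

/-- (chain bookkeeping) [folklore] -/
theorem planarStep_mem (a b : ℤ) :
    planarStep a b ∈ [((1 : ℤ), (-1 : ℤ)), (-1, 1), (1, 0), (-1, 0), (0, 1), (0, -1)] := by
  unfold planarStep
  split_ifs <;> simp

/-- (chain bookkeeping) [folklore] -/
theorem planarChain_sub_nnList (m : Fin 2) : ∀ (fuel : ℕ) (a b : ℤ), ∀ s ∈ planarChain m fuel a b, s ∈ nnList := by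
  intro fuel
  induction fuel with
  | zero => intro a b s hs; simp [planarChain] at hs
  | succ fuel ih =>
      intro a b s hs
      simp only [planarChain] at hs
      split_ifs at hs with h0
      · simp at hs
      · rcases List.mem_cons.mp hs with rfl | hs'
        · have hp := planarStep_mem a b
          generalize planarStep a b = p at hp ⊢
          simp only [List.mem_cons, List.mem_nil_iff, or_false] at hp
          fin_cases m <;> rcases hp with rfl | rfl | rfl | rfl | rfl | rfl <;> decide
        · exact ih _ _ s hs'

/-- (chain bookkeeping) [folklore] -/
theorem vertChain_sub_nnList (up : Bool) : ∀ (k : ℕ) (cur : Fin 2) (acc tgt : Fin 3 → ℤ), ∀ s ∈ vertChain cur up k acc tgt, s ∈ nnList := by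
  intro k
  induction k with
  | zero => intro cur acc tgt s hs; exact planarChain_sub_nnList cur _ _ _ s hs
  | succ k ih =>
      intro cur acc tgt s hs
      simp only [vertChain] at hs
      rcases List.mem_cons.mp hs with rfl | hs'
      · rcases argminD_mem (fun s => triDist (tgt 0 - acc 0 - s.2.2 0) (tgt 1 - acc 1 - s.2.2 1))
            ((vertClasses cur up).headD (0, 0, 0)) (vertClasses cur up) with h | h
        · rw [h]; exact vertClasses_sub_nnList cur up _ (vertClasses_headD_mem cur up)
        · exact vertClasses_sub_nnList cur up _ h
      · exact ih _ _ _ s hs'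

/-- **every step of `chainNN c` is a nearest-neighbour class.** [folklore] -/
theorem chainNN_sub_nnList (c : BondClass) : ∀ s ∈ chainNN c, s ∈ nnList := by
  unfold chainNN
  exact vertChain_sub_nnList _ _ _ _ _

/-- hence the Boolean check `chainsNN` holds for every range WITHOUT evaluation. [folklore] -/
theorem chainsNN_eq_true (qn qf : ℤ) : chainsNN qn qf = true := by
  unfold chainsNN
  rw [List.all_eq_true]
  intro c _
  rw [List.all_eq_true]
  intro s hs
  exact decide_eq_true (chainNN_sub_nnList c s hs)

/-- `ValidChains` from the fast check. [folklore] -/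
theorem validChains_of_checkF {Rn Rf : ℝ} {bn bf : ℕ} {qn qf : ℤ} (hbn : ⌈2 * Rn⌉₊ + 1 = bn)
    (hqn : ((qn : ℤ) : ℝ) = 36 * Rn ^ 2) (hbf : ⌈2 * Rf⌉₊ + 1 = bf) (hqf : ((qf : ℤ) : ℝ) = 36 * Rf ^ 2)
    (hRn : 0 ≤ Rn) (hRf : 0 ≤ Rf) (h : validChainsF qn qf = true) : ValidChains Rn Rf chainNN := by
  intro c hc
  rw [farClasses_eq_toFinset hbn hqn hbf hqf hRn hRf, List.mem_toFinset] at hc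
  unfold validChainsF at h
  rw [List.all_eq_true] at h
  have h1 := h c hc
  simp only [Bool.and_eq_true, List.all_eq_true, Bool.not_eq_true', decide_eq_false_iff_not,
    chainNNF_eq_chainNN] at h1
  exact ⟨isChain_of_isChainB h1.1, fun s hs => h1.2 s hs⟩

/-- Anchor of this support file (registered stub of the line skeleton, lead c2). -/
theorem stub_certChainFast : ∀ qn qf : ℤ, chainsNN qn qf = true :=
  fun qn qf => chainsNN_eq_true qn qf

end Summit.AtomisticToContinuum.Crystallization.Theorems.PhononStabilityCWC.Cert

end
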